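import Summits.QuantumFields.YangMills.Theorems.OneCertifiedCubeFiniteSizeCriterion
import Summits.QuantumFields.YangMills.Theorems.ConvexGribovBodyNonSimplyConnectedLatticeGapStubInfluenceAntitone
import HarnessLib

/-!
# `NonSimplyConnectedLatticeGap` — stub ANTI of line `Sketch` v10: the mean cube influence is antitone in the radius
# (stub `stub_meanBoxInfluence_antitone` of crux stmt-QuantumFields-16405, route `ConvexGribovBody`)

At fixed `(G, ρ, β, A)` and fixed torus side `2S+1`, with `supp A ⊆ Λ_L = [−L,L]⁴ × (4 directions)`, `L ≤ L'` and
`L' + 1 ≤ S`: the `L¹(μ_S)` oscillation of the kernel mean `γ_{Λ_{L'}}(A | Ũ)` of the Wilson specification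
`γ = ymSpecification ρ β` around the torus mean `μ_S(A)` of the torus Wilson state `μ_S = wilsonMeasure ρ β` is at
most the same quantity for the smaller cube `Λ_L`.

Proof (Georgii 2011, Def. 1.23 (iii) and §8.2): with `g(η) = γ_{Λ_L}(A | η)` and `c = μ_S(A)`,
* consistency `γ_{Λ_{L'}} γ_{Λ_L} = γ_{Λ_{L'}}` (`IsSpecification.integral_integral_consistent`) and Jensen give
  `|γ_{Λ_{L'}}(A | η) − c| = |∫ (g − c) dγ_{Λ_{L'}}(· | η)| ≤ γ_{Λ_{L'}}(|g − c|)(η)` for every `η`;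
* `F = |g − c|` is a bounded measurable cylinder function supported in `supp A ∪ ∂Λ_L`
  (`dependsOn_integral_ymSpecification`, quasilocality of the finite-range specification), and `Λ_{L'}` together with
  that support and its own collar is based in `[−L'−1, L'+1]⁴`, of width `2L'+3 ≤ 2S+1`, hence injects into the torus;
* so the torus DLR identity in volume `Λ_{L'}` with far factor `1`
  (`FiniteSizeCriterion.integral_torusLift_mul_eq_integral_ymSpecification_mul_of_measurable`) gives
  `∫ γ_{Λ_{L'}}(F)(Ũ) dμ_S = ∫ F(Ũ) dμ_S`, which is the mean influence at radius `L`.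
-/

set_option autoImplicit false

noncomputable section

open MeasureTheory Filter
open Literature.Probability.LatticeModels
open Literature.MathematicalPhysics.QuantumLattice
open Literature.MathematicalPhysics.QuantumFieldTheory (GaugeConfig wilsonMeasure isProbabilityMeasure_wilsonMeasure
  measurable_torusLift isSpecification_ymSpecification_of_t2Space)

namespace Summit.QuantumFields.YangMills.Theorems.NonSimplyConnectedLatticeGap

/-- **The mean cube influence is antitone in the radius** (registered stub `stub_meanBoxInfluence_antitone`, ANTI, of
the skeleton `Cruxes/NonSimplyConnectedLatticeGap/Lines/Sketch.lean` v10 of item stmt-QuantumFields-16405): for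
`supp A ⊆ Λ_L`, `L ≤ L'`, `L' + 1 ≤ S`, the `L¹(μ_S)` oscillation of `γ_{Λ_{L'}}(A | Ũ)` around `μ_S(A)` is at most
that of `γ_{Λ_L}(A | Ũ)` — consistency of the Wilson specification, Jensen, and the torus DLR identity in volume
`Λ_{L'}` for the bounded cylinder function `|γ_{Λ_L}(A | ·) − μ_S(A)|` (Georgii 2011, Def. 1.23 (iii), §8.2). -/
theorem stub_meanBoxInfluence_antitone : ∀ (G : Type) [Group G] [TopologicalSpace G] [IsTopologicalGroup G] [CompactSpace G] [MeasurableSpace G] [BorelSpace G] [SecondCountableTopology G] [T2Space G] (N : ℕ) (ρ : G →* Matrix (Fin N) (Fin N) ℂ), Continuous ρ → ∀ (β : ℝ) (A : Literature.MathematicalPhysics.QuantumLattice.LocalGaugeObservable 4 G) (L L' S : ℕ), A.supp ⊆ ((Fintype.piFinset fun _ : Fin 4 => Finset.Icc (-((L : ℕ) : ℤ)) ((L : ℕ) : ℤ)) ×ˢ (Finset.univ : Finset (Fin 4))) → L ≤ L' → L' + 1 ≤ S → ∫ V, |(∫ U, A.F U ∂(Literature.MathematicalPhysics.QuantumLattice.ymSpecification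 ρ β ((Fintype.piFinset fun _ : Fin 4 => Finset.Icc (-((L' : ℕ) : ℤ)) ((L' : ℕ) : ℤ)) ×ˢ (Finset.univ : Finset (Fin 4))) (Literature.MathematicalPhysics.QuantumLattice.torusLift (2 * S + 1) V))) - ∫ W, A.F (Literature.MathematicalPhysics.QuantumLattice.torusLift (2 * S + 1) W) ∂(Literature.MathematicalPhysics.QuantumFieldTheory.wilsonMeasure ρ β : MeasureTheory.Measure (Literature.MathematicalPhysics.QuantumFieldTheory.GaugeConfig 4 (2 * S + 1) G))| ∂(Literature.MathematicalPhysics.QuantumFieldTheory.wilsonMeasure ρ β : MeasureTheory.Measure (Literature.MathematicalPhysics.QuantumFieldTheory.GaugeConfig 4 (2 * S + 1) G)) ≤ ∫ V, |(∫ U, A.F U ∂(Literature.MathematicalPhysics.QuantumLattice.ymSpecification ρ β ((Fintype.piFinset fun _ : Fin 4 => Finset.Icc (-((L : ℕ) : ℤ)) ((L : ℕ) : ℤ)) ×ˢ (Finset.univ : Finset (Fin 4))) (Literature.MathematicalPhysics.QuantumLattice.torusLift (2 * S + 1) V))) - ∫ W, A.F (Literature.MathematicalPhysics.QuantumLattice.torusLift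 (2 * S + 1) W) ∂(Literature.MathematicalPhysics.QuantumFieldTheory.wilsonMeasure ρ β : MeasureTheory.Measure (Literature.MathematicalPhysics.QuantumFieldTheory.GaugeConfig 4 (2 * S + 1) G))| ∂(Literature.MathematicalPhysics.QuantumFieldTheory.wilsonMeasure ρ β : MeasureTheory.Measure (Literature.MathematicalPhysics.QuantumFieldTheory.GaugeConfig 4 (2 * S + 1) G)) := by
  intro G _ _ _ _ _ _ _ _ N ρ hρ β A L L' S hAsupp hLL' hL'S
  classical
  haveI := isProbabilityMeasure_wilsonMeasure (d := 4) (L := 2 * S + 1) ρ hρ β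
  have hγ := isSpecification_ymSpecification_of_t2Space (d := 4) ρ hρ β
  obtain ⟨CA, hCA⟩ := A.bounded
  have hL'S' : (L' : ℤ) + 1 ≤ S := by exact_mod_cast hL'S
  have hLL'z : (L : ℤ) ≤ L' := by exact_mod_cast hLL'
  -- the cubes `Λ ⊆ Λ'` of radii `L ≤ L'`
  obtain ⟨Λ, hΛ⟩ : ∃ Λ : Finset (ZdEdge 4), Λ = (Fintype.piFinset fun _ : Fin 4 =>
    Finset.Icc (-((L : ℕ) : ℤ)) ((L : ℕ) : ℤ)) ×ˢ (Finset.univ : Finset (Fin 4)) := ⟨_, rfl⟩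
  obtain ⟨Λ', hΛ'⟩ : ∃ Λ' : Finset (ZdEdge 4), Λ' = (Fintype.piFinset fun _ : Fin 4 =>
    Finset.Icc (-((L' : ℕ) : ℤ)) ((L' : ℕ) : ℤ)) ×ˢ (Finset.univ : Finset (Fin 4)) := ⟨_, rfl⟩
  rw [← hΛ] at hAsupp ⊢
  rw [← hΛ']
  have hmemΛ : ∀ e ∈ Λ, ∀ i, -(L : ℤ) ≤ e.1 i ∧ e.1 i ≤ L := by
    intro e he i
    rw [hΛ, Finset.mem_product, Fintype.mem_piFinset] at he
    exact Finset.mem_Icc.1 (he.1 i)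
  have hmemΛ' : ∀ e ∈ Λ', ∀ i, -(L' : ℤ) ≤ e.1 i ∧ e.1 i ≤ L' := by
    intro e he i
    rw [hΛ', Finset.mem_product, Fintype.mem_piFinset] at he
    exact Finset.mem_Icc.1 (he.1 i)
  have hsub : Λ ⊆ Λ' := by
    rw [hΛ, hΛ']
    exact Finset.product_subset_product_left (Fintype.piFinset_subset _ _ fun _ =>
      Finset.Icc_subset_Icc (neg_le_neg hLL'z) hLL'z)
  -- the kernel mean `g` of `A` in the smaller cube, the torus mean `c`, and the oscillation `F = |g - c|`
  set c : ℝ := ∫ W, A.F (torusLift (2 * S + 1) W) ∂(wilsonMeasure (d := 4) (L := 2 * S + 1) ρ β) with hc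
  set g : LGConfig 4 G → ℝ := fun η => ∫ U, A.F U ∂(ymSpecification ρ β Λ η) with hgdef
  have hgm : Measurable g := DobrushinShlosman.measurable_windowAvg' hγ Λ A.measurable
  have hgb : ∀ η, |g η| ≤ CA := fun η => abs_integral_ymSpecification_le ρ hρ β Λ hCA η
  have hgS : IsCylinder g (A.supp ∪ (plaquettesTouching Λ).biUnion plaquetteEdges) :=
    dependsOn_integral_ymSpecification ρ hρ β Λ A.measurable A.isCylinder
  set F : LGConfig 4 G → ℝ := fun η => |g η - c| with hFdef
  have hFm : Measurable F := (hgm.sub_const c).abs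
  have hFb : ∀ η, |F η| ≤ CA + |c| := fun η => by
    rw [hFdef, abs_abs]
    exact (abs_sub _ _).trans (add_le_add (hgb η) le_rfl)
  have hFS : IsCylinder F (A.supp ∪ (plaquettesTouching Λ).biUnion plaquetteEdges) := fun η η' h => by
    simp only [hFdef, hgS h]
  -- (i) consistency + Jensen: `|γ_{Λ'}(A | η) - c| ≤ γ_{Λ'}(F)(η)` for every exterior datum `η`
  have hpt : ∀ η : LGConfig 4 G, |(∫ U, A.F U ∂(ymSpecification ρ β Λ' η)) - c| ≤
      ∫ σ, F σ ∂(ymSpecification ρ β Λ' η) := by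
    intro η
    haveI := hγ.isProbability Λ' η
    have hfi : Integrable A.F (ymSpecification ρ β Λ' η) :=
      DobrushinMetric.integrable_of_abs_le' A.measurable hCA
    have hgi : Integrable g (ymSpecification ρ β Λ' η) := DobrushinMetric.integrable_of_abs_le' hgm hgb
    rw [← hγ.integral_integral_consistent hsub η hfi]
    change |(∫ σ, g σ ∂(ymSpecification ρ β Λ' η)) - c| ≤ ∫ σ, |g σ - c| ∂(ymSpecification ρ β Λ' η)
    have e : (∫ σ, g σ ∂(ymSpecification ρ β Λ' η)) - c = ∫ σ, (g σ - c) ∂(ymSpecification ρ β Λ' η) := by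
      rw [integral_sub hgi (integrable_const c), integral_const]
      simp
    rw [e]
    exact abs_integral_le_integral_abs
  -- (ii) `Λ'`, the support of `F` and the collar of `Λ'` inject into the torus of side `2S+1`
  have hwide : ∀ e ∈ Λ' ∪ (A.supp ∪ (plaquettesTouching Λ).biUnion plaquetteEdges) ∪
      (plaquettesTouching Λ').biUnion plaquetteEdges, ∀ i, -(L' : ℤ) - 1 ≤ e.1 i ∧ e.1 i ≤ L' + 1 := by
    intro e he i
    simp only [Finset.mem_union] at he
    rcases he with (he | he | he) | he
    · have h := hmemΛ' e he i
      constructor <;> linarith only [h.1, h.2]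
    · have h := hmemΛ e (hAsupp he) i
      constructor <;> linarith only [h.1, h.2, hLL'z]
    · obtain ⟨e', he', hn'⟩ := exists_near_of_mem_collar he
      have h := hmemΛ e' he' i
      have h' := hn' i
      constructor <;> linarith only [h.1, h.2, h'.1, h'.2, hLL'z]
    · obtain ⟨e', he', hn'⟩ := exists_near_of_mem_collar he
      have h := hmemΛ' e' he' i
      have h' := hn' i
      constructor <;> linarith only [h.1, h.2, h'.1, h'.2]
  have hinj : Set.InjOn (Torus.proj (2 * S + 1))
      ((Λ' ∪ (A.supp ∪ (plaquettesTouching Λ).biUnion plaquetteEdges) ∪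
        (plaquettesTouching Λ').biUnion plaquetteEdges).image Prod.fst : Set (Site 4)) := by
    refine (FiniteSizeCriterion.injOn_torusProj_of_width (M := 2 * S + 1) (lo := -(L' : ℤ) - 1)
      (hi := (L' : ℤ) + 1) (by push_cast; linarith only [hL'S'])).mono fun x hx => ?_
    obtain ⟨e, he, rfl⟩ := Finset.mem_image.1 (Finset.mem_coe.1 hx)
    exact hwide e he
  -- (iii) DLR on the torus in volume `Λ'` with far factor `1`, for the cylinder function `F`
  have h2 := FiniteSizeCriterion.integral_torusLift_mul_eq_integral_ymSpecification_mul_of_measurable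
    ρ hρ β Λ' hFm hFb hFS hinj (H := fun _ => (1 : ℝ)) measurable_const (D := 1)
    (fun _ => by simp) (fun _ _ => rfl)
  simp only [mul_one] at h2
  -- (iv) integrate (i) over the torus state and use (iii)
  have hInt : Integrable (fun V : GaugeConfig 4 (2 * S + 1) G =>
      ∫ U, F U ∂(ymSpecification ρ β Λ' (torusLift (2 * S + 1) V)))
      (wilsonMeasure (d := 4) (L := 2 * S + 1) ρ β) :=
    Literature.MathematicalPhysics.QuantumLattice.integrable_of_abs_le
      ((DobrushinShlosman.measurable_windowAvg' hγ Λ' hFm).comp (measurable_torusLift (2 * S + 1)))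
      fun V => DobrushinShlosman.abs_windowAvg_le' hγ Λ' hFb _
  have key : ∫ V, |(∫ U, A.F U ∂(ymSpecification ρ β Λ' (torusLift (2 * S + 1) V))) - c|
      ∂(wilsonMeasure (d := 4) (L := 2 * S + 1) ρ β) ≤
      ∫ V, (∫ U, F U ∂(ymSpecification ρ β Λ' (torusLift (2 * S + 1) V)))
        ∂(wilsonMeasure (d := 4) (L := 2 * S + 1) ρ β) :=
    integral_mono_of_nonneg (ae_of_all _ fun V => abs_nonneg _) hInt (ae_of_all _ fun V => hpt _)
  exact key.trans_eq h2.symm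

/-! ## Consequences: the trivial bound and "coarse scales suffice" for the averaged leaf -/

section Progression

variable {N : ℕ} {G : Type} [Group G] [TopologicalSpace G] [IsTopologicalGroup G]
  [CompactSpace G] [MeasurableSpace G] [BorelSpace G] [SecondCountableTopology G] [T2Space G]
  (ρ : G →* Matrix (Fin N) (Fin N) ℂ)

omit [T2Space G] in
/-- The trivial bound on the mean cube influence: `∫ |γ_Λ(A | Ũ) − μ_S(A)| dμ_S(U) ≤ 2 ‖A‖_∞` for every finite link
set `Λ` and every torus side `2S+1` (both means are averages of `A` against probability measures). -/
theorem meanBoxInfluence_le_two_mul (hρ : Continuous ρ) (β : ℝ) (A : LocalGaugeObservable 4 G) {CA : ℝ}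
    (hCA : ∀ U, |A.F U| ≤ CA) (Λ : Finset (ZdEdge 4)) (S : ℕ) :
    ∫ V, |(∫ U, A.F U ∂(ymSpecification ρ β Λ (torusLift (2 * S + 1) V))) -
        ∫ W, A.F (torusLift (2 * S + 1) W) ∂(wilsonMeasure ρ β : Measure (GaugeConfig 4 (2 * S + 1) G))|
      ∂(wilsonMeasure ρ β : Measure (GaugeConfig 4 (2 * S + 1) G)) ≤ 2 * CA := by
  haveI := isProbabilityMeasure_wilsonMeasure (d := 4) (L := 2 * S + 1) ρ hρ β
  have hc : |∫ W, A.F (torusLift (2 * S + 1) W) ∂(wilsonMeasure (d := 4) (L := 2 * S + 1) ρ β)| ≤ CA :=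
    Literature.MathematicalPhysics.QuantumLattice.abs_integral_le_of_abs_le fun W => hCA _
  refine (le_abs_self _).trans
    (Literature.MathematicalPhysics.QuantumLattice.abs_integral_le_of_abs_le fun V => ?_)
  rw [abs_abs]
  have hg := abs_integral_ymSpecification_le ρ hρ β Λ hCA (torusLift (2 * S + 1) V)
  exact (abs_sub _ _).trans (by linarith only [hg, hc])

/-- **Coarse scales suffice for the averaged leaf A″.** If the mean cube influence of `A` decays like `C e^{-m k}`
along the cubes of radius `b k` (whenever `supp A ⊆ Λ_{bk}` and `b k + 1 ≤ S`), then on every cube `Λ_L ⊇ supp A`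
with `L + 1 ≤ S` it is at most `(C e^{m} + 2‖A‖_∞ e^{(m/b)(R+b)}) e^{-(m/b) L}`, `R` being any radius with
`supp A ⊆ Λ_R` (no hypothesis `supp A ⊆ Λ_L` is needed): for `k = L / b` either `supp A ⊆ Λ_{bk}` and
`stub_meanBoxInfluence_antitone` brings the bound at radius `b k ≤ L` up to radius `L < b (k+1)`, or `b k < R`, so
`L < R + b`, and the trivial bound `meanBoxInfluence_le_two_mul` suffices. -/
theorem meanBoxInfluenceDecay_of_progression (hρ : Continuous ρ) (β : ℝ) {b : ℕ} (hb : 1 ≤ b) {m : ℝ}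
    (hm : 0 ≤ m) (A : LocalGaugeObservable 4 G) {CA : ℝ} (hCA : ∀ U, |A.F U| ≤ CA) {R : ℕ}
    (hR : A.supp ⊆ (Fintype.piFinset fun _ : Fin 4 => Finset.Icc (-((R : ℕ) : ℤ)) ((R : ℕ) : ℤ)) ×ˢ
      (Finset.univ : Finset (Fin 4))) {C : ℝ} (hC : 0 ≤ C)
    (hdec : ∀ k S : ℕ, A.supp ⊆ (Fintype.piFinset fun _ : Fin 4 => Finset.Icc (-((b * k : ℕ) : ℤ))
        ((b * k : ℕ) : ℤ)) ×ˢ (Finset.univ : Finset (Fin 4)) → b * k + 1 ≤ S →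
      ∫ V, |(∫ U, A.F U ∂(ymSpecification ρ β ((Fintype.piFinset fun _ : Fin 4 =>
          Finset.Icc (-((b * k : ℕ) : ℤ)) ((b * k : ℕ) : ℤ)) ×ˢ (Finset.univ : Finset (Fin 4)))
          (torusLift (2 * S + 1) V))) -
        ∫ W, A.F (torusLift (2 * S + 1) W) ∂(wilsonMeasure ρ β : Measure (GaugeConfig 4 (2 * S + 1) G))|
        ∂(wilsonMeasure ρ β : Measure (GaugeConfig 4 (2 * S + 1) G)) ≤ C * Real.exp (-(m * k)))
    (L S : ℕ) (hLS : L + 1 ≤ S) :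
    ∫ V, |(∫ U, A.F U ∂(ymSpecification ρ β ((Fintype.piFinset fun _ : Fin 4 =>
        Finset.Icc (-((L : ℕ) : ℤ)) ((L : ℕ) : ℤ)) ×ˢ (Finset.univ : Finset (Fin 4))) (torusLift (2 * S + 1) V))) -
      ∫ W, A.F (torusLift (2 * S + 1) W) ∂(wilsonMeasure ρ β : Measure (GaugeConfig 4 (2 * S + 1) G))|
      ∂(wilsonMeasure ρ β : Measure (GaugeConfig 4 (2 * S + 1) G)) ≤
      (C * Real.exp m + 2 * CA * Real.exp (m / b * (R + b))) * Real.exp (-(m / b * L)) := by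
  have hCA0 : 0 ≤ CA := (abs_nonneg _).trans (hCA 1)
  have hb0 : 0 < b := hb
  have hbr : (0 : ℝ) < b := by exact_mod_cast hb0
  have hmb : 0 ≤ m / b := div_nonneg hm hbr.le
  have hE : 0 ≤ Real.exp (-(m / b * L)) := (Real.exp_pos _).le
  have h4 : 0 ≤ C * Real.exp m * Real.exp (-(m / b * L)) :=
    mul_nonneg (mul_nonneg hC (Real.exp_pos _).le) hE
  have h5 : 0 ≤ 2 * CA * Real.exp (m / b * (R + b)) * Real.exp (-(m / b * L)) :=
    mul_nonneg (mul_nonneg (mul_nonneg two_pos.le hCA0) (Real.exp_pos _).le) hE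
  -- the coarse scale `k = L / b`: `b k ≤ L < b (k + 1)`
  obtain ⟨k, hk⟩ : ∃ k : ℕ, k = L / b := ⟨_, rfl⟩
  have hkL : b * k ≤ L := by rw [hk]; exact Nat.mul_div_le L b
  have hLk : L < b * (k + 1) := by rw [hk]; exact Nat.lt_mul_div_succ L hb0
  by_cases hAk : A.supp ⊆ (Fintype.piFinset fun _ : Fin 4 => Finset.Icc (-((b * k : ℕ) : ℤ))
      ((b * k : ℕ) : ℤ)) ×ˢ (Finset.univ : Finset (Fin 4))
  · -- antitonicity down to the radius `b k ≤ L`, then the hypothesis at scale `k`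
    have h1 := stub_meanBoxInfluence_antitone G N ρ hρ β A (b * k) L S hAk hkL hLS
    have h2 := hdec k S hAk ((Nat.succ_le_succ hkL).trans hLS)
    refine (h1.trans h2).trans ?_
    -- `C e^{-m k} ≤ C e^{m} e^{-(m/b) L}` since `L < b (k + 1)`
    have h3 : Real.exp (-(m * k)) ≤ Real.exp m * Real.exp (-(m / b * L)) := by
      rw [← Real.exp_add]
      refine Real.exp_le_exp.2 ?_
      have hL' : (L : ℝ) ≤ b * (k + 1) := by exact_mod_cast hLk.le
      have e1 : m / b * L ≤ m / b * (b * (k + 1)) := mul_le_mul_of_nonneg_left hL' hmb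
      have e2 : m / b * (b * ((k : ℝ) + 1)) = m * (k + 1) := by
        field_simp
      rw [e2] at e1
      linarith only [e1]
    have h3' := mul_le_mul_of_nonneg_left h3 hC
    linarith only [h3', h5]
  · -- small cubes: `b k < R`, so `L < R + b`, and the trivial bound `2 ‖A‖_∞` suffices
    have hbk : b * k < R := by
      refine not_le.1 fun hcon => hAk (hR.trans ?_)
      have h : ((R : ℕ) : ℤ) ≤ ((b * k : ℕ) : ℤ) := by exact_mod_cast hcon
      exact Finset.product_subset_product_left (Fintype.piFinset_subset _ _ fun _ =>
        Finset.Icc_subset_Icc (neg_le_neg h) h)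
    have hLR : (L : ℝ) ≤ R + b := by
      have h : L < R + b := by linarith [hLk, hbk]
      exact_mod_cast h.le
    refine (meanBoxInfluence_le_two_mul ρ hρ β A hCA _ S).trans ?_
    -- `2 ‖A‖ ≤ 2 ‖A‖ e^{(m/b)(R+b)} e^{-(m/b) L}` and `0 ≤ C e^{m} e^{-(m/b) L}`
    have h3 : 1 ≤ Real.exp (m / b * (R + b)) * Real.exp (-(m / b * L)) := by
      rw [← Real.exp_add]
      refine Real.one_le_exp ?_
      nlinarith [mul_le_mul_of_nonneg_left hLR hmb]
    have h3' := mul_le_mul_of_nonneg_left h3 (mul_nonneg two_pos.le hCA0)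
    linarith only [h3', h4]

end Progression

end Summit.QuantumFields.YangMills.Theorems.NonSimplyConnectedLatticeGap

end
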